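import Summits.AnomalousDissipation.AnomalousDissipation.Theses.TwoAndHalfD
import Summits.AnomalousDissipation.AnomalousDissipation.Theorems.TwoAndHalfDTwohalfdThesisStubCoherenceOfEnergy
import Summits.AnomalousDissipation.AnomalousDissipation.Theorems.TwoAndHalfDScalarAnomalySteadySourceFormalColdStartVarianceToolkit
import Literature.Analysis.FluidPDE.PassiveScalarClassicalEnergy

/-!
# C1 `stub_dissipationTimeLowerBound`: uniform dissipation time ≥ advective time

Stub C1 of the line `Sketch` (duhamel-release) for the crux
`Summit.AnomalousDissipation.AnomalousDissipation.Theses.TwoAndHalfD.TwohalfdThesis`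
(stmt-AnomalousDissipation-0206); the statement is registered verbatim on the item.

CONTENT. Let `0 ≤ κ ≤ 1`, let `h` be a smooth pattern on `T²`, and let `φ` be a classical solution
of `∂ₜφ + u·∇φ = κΔφ`, `div u = 0`, on `[s₀, ∞) × T²` released from `φ(s₀) = h`, the drift having
kinetic energy `∫ ‖u(t)‖² ≤ E` (`t ≥ s₀`). If the release decays under an envelope
`‖φ(t)‖²_{L²} ≤ Λ(t - s₀)² ‖h‖²_{L²}` with `Λ ≥ 0` integrable on `[0, ∞)`, then the "dissipation
time" `∫₀^∞ Λ` is at least the advective time `‖h‖² / (2K)`,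
`K := (‖Δh‖_{L²} + ‖∇h‖_{L^∞} √E) ‖h‖_{L²}`:

  `‖h‖²_{L²} ≤ 2 K ∫₀^∞ Λ`.

PROOF. Write `L := ‖h‖²`. The coherence gate `stub_coherenceOfEnergy` gives
`L - K τ ≤ ∫ h φ(s₀ + τ)` for `τ ≥ 0`, and Cauchy–Schwarz with the envelope gives
`∫ h φ(s₀ + τ) ≤ ‖h‖ ‖φ(s₀ + τ)‖ ≤ ‖h‖ Λ(τ) ‖h‖ = Λ(τ) L`. Integrating `L - K τ ≤ Λ(τ) L` over
`(0, T]` and using `Λ ≥ 0`: `L T - K T²/2 ≤ L ∫₀^∞ Λ` for every `T ≥ 0`. If `L = 0` the claim is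
`0 ≤ 2K∫Λ`; if `L > 0` and `K = 0`, `T := ∫Λ + 1` is absurd; if `K > 0`, `T := L/K` gives
`L²/(2K) ≤ L ∫Λ`. Supports stmt-AnomalousDissipation-0206. [folklore: DEIJ 2022, §1 (1.1)–(1.3)]
-/

noncomputable section

-- the summit path `AnomalousDissipation/AnomalousDissipation` duplicates a namespace component
set_option linter.dupNamespace false

namespace Summit.AnomalousDissipation.AnomalousDissipation.Theorems.TwohalfdThesis

open MeasureTheory Set Filter Topology
open scoped ENNReal NNReal InnerProductSpace
open Literature.Analysis.FunctionSpaces Literature.Analysis.FluidPDE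

/-! ## Real-variable core -/

/-- `∫_{(0,T]} (L - K τ) dτ = L T - K T² / 2` for `T ≥ 0`. [folklore] -/
private theorem integral_Ioc_const_sub_mul {L K T : ℝ} (hT : 0 ≤ T) :
    ∫ τ in Ioc 0 T, (L - K * τ) = L * T - K * T ^ 2 / 2 := by
  have h1 : IntervalIntegrable (fun _ : ℝ => L) volume 0 T := intervalIntegrable_const
  have h2 : IntervalIntegrable (fun τ : ℝ => K * τ) volume 0 T :=
    (continuous_const.mul continuous_id).intervalIntegrable _ _
  rw [← intervalIntegral.integral_of_le hT, intervalIntegral.integral_sub h1 h2,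
    intervalIntegral.integral_const, intervalIntegral.integral_const_mul, integral_id, smul_eq_mul]
  ring

/-- **The real-variable core.** If `L, K ≥ 0`, `Λ ≥ 0` is integrable on `[0, ∞)` and
`L - K τ ≤ Λ(τ) L` for all `τ ≥ 0`, then `L ≤ 2 K ∫₀^∞ Λ`: integrate the hypothesis over `(0, T]`
to get `L T - K T²/2 ≤ L ∫₀^∞ Λ`, then take `T := ∫Λ + 1` (case `K = 0`, absurd unless `L = 0`) or
`T := L / K` (case `K > 0`). [folklore] -/
private theorem le_two_mul_mul_integral_of_envelope {L K : ℝ} {Λ : ℝ → ℝ} (hL : 0 ≤ L)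
    (hK : 0 ≤ K) (hΛ0 : ∀ τ, 0 ≤ Λ τ) (hΛint : IntegrableOn Λ (Ici 0))
    (hstar : ∀ τ, 0 ≤ τ → L - K * τ ≤ Λ τ * L) :
    L ≤ 2 * K * ∫ τ in Ici 0, Λ τ := by
  set I := ∫ τ in Ici 0, Λ τ with hI_def
  have hI0 : 0 ≤ I := setIntegral_nonneg measurableSet_Ici fun τ _ => hΛ0 τ
  -- integrate `hstar` over `(0, T]`
  have hdag : ∀ T, 0 ≤ T → L * T - K * T ^ 2 / 2 ≤ L * I := by
    intro T hT
    have hsub : Ioc 0 T ⊆ Ici 0 := fun τ hτ => mem_Ici.2 hτ.1.le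
    have hΛT : IntegrableOn Λ (Ioc 0 T) := hΛint.mono_set hsub
    have h1 : ∫ τ in Ioc 0 T, (L - K * τ) ≤ ∫ τ in Ioc 0 T, Λ τ * L :=
      setIntegral_mono_on
        ((continuous_const.sub (continuous_const.mul continuous_id)).integrableOn_Ioc)
        (hΛT.mul_const L) measurableSet_Ioc fun τ hτ => hstar τ hτ.1.le
    have h2 : ∫ τ in Ioc 0 T, Λ τ * L = (∫ τ in Ioc 0 T, Λ τ) * L := integral_mul_const L _
    have h3 : ∫ τ in Ioc 0 T, Λ τ ≤ I :=
      setIntegral_mono_set hΛint (Eventually.of_forall fun τ => hΛ0 τ)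
        (Eventually.of_forall hsub)
    rw [integral_Ioc_const_sub_mul hT, h2] at h1
    have h4 : (∫ τ in Ioc 0 T, Λ τ) * L ≤ I * L := mul_le_mul_of_nonneg_right h3 hL
    linarith
  rcases hL.eq_or_lt with hL0 | hLpos
  · -- `L = 0`
    rw [← hL0]
    exact mul_nonneg (mul_nonneg two_pos.le hK) hI0
  rcases hK.eq_or_lt with hK0 | hKpos
  · -- `K = 0`: `Λ ≥ 1` on `[0, ∞)` is not integrable
    exfalso
    have h := hdag (I + 1) (by linarith)
    rw [← hK0, zero_mul, zero_div, sub_zero] at h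
    nlinarith
  · -- `K > 0`: take `T := L / K`
    set T := L / K with hT_def
    have hT0 : 0 ≤ T := div_nonneg hL hK
    have hKT : K * T = L := by rw [hT_def]; field_simp
    have h := hdag T hT0
    have e : K * T ^ 2 = L * T := by rw [sq, ← mul_assoc, hKT]
    have h' : L * T ≤ L * (2 * I) := by
      have e2 : K * T ^ 2 / 2 = L * T / 2 := by rw [e]
      rw [e2] at h
      linarith
    have hT2 : T ≤ 2 * I := le_of_mul_le_mul_left h' hLpos
    calc L ≤ 2 * I * K := (div_le_iff₀ hKpos).1 hT2
      _ = 2 * K * I := by ring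

/-! ## The stub -/

/-- **C1 `stub_dissipationTimeLowerBound` (line `Sketch` = duhamel-release, crux
`TwoAndHalfD.TwohalfdThesis`): uniform dissipation time ≥ advective time.** Let `0 ≤ κ ≤ 1`,
`h` smooth on `T²`, `φ` a classical solution of `∂ₜφ + u·∇φ = κΔφ`, `div u = 0`, on
`[s₀, ∞) × T²` with `φ(s₀) = h`, `∫ ‖u(t)‖² ≤ E` for `t ≥ s₀`, and suppose the `L²` envelope
`‖φ(t)‖² ≤ Λ(t - s₀)² ‖h‖²` with `Λ ≥ 0` integrable on `[0, ∞)`. Then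
`‖h‖²_{L²} ≤ 2 (‖Δh‖_{L²} + (sup ‖∇h‖) √E) ‖h‖_{L²} ∫₀^∞ Λ`. Proof: the coherence gate
`stub_coherenceOfEnergy` and Cauchy–Schwarz give `‖h‖² - K τ ≤ ∫ h φ(s₀ + τ) ≤ Λ(τ) ‖h‖²`
(`τ ≥ 0`); integrate over `(0, T]` and optimise in `T`
(`le_two_mul_mul_integral_of_envelope`). [folklore] -/
theorem stub_dissipationTimeLowerBound : ∀ (κ E s₀ : ℝ) (u : ℝ → (UnitAddTorus (Fin 2)) → (EuclideanSpace ℝ (Fin 2))) (h : (UnitAddTorus (Fin 2)) → ℝ) (φ : ℝ → (UnitAddTorus (Fin 2)) → ℝ) (Λ : ℝ → ℝ), 0 ≤ κ → κ ≤ 1 → Torus.IsSmooth h → Torus.IsClassicalScalarTransportOn (Ici s₀) κ u φ → φ s₀ = h → (∀ t, s₀ ≤ t → ∫ x, ‖u t x‖ ^ 2 ≤ E) → (∀ τ, 0 ≤ Λ τ) → IntegrableOn Λ (Ici 0) → (∀ t, s₀ ≤ t → Torus.scalarL2Sq (φ t) ≤ Λ (t - s₀) ^ 2 * Torus.scalarL2Sq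 h) → Torus.scalarL2Sq h ≤ 2 * ((Real.sqrt (Torus.scalarL2Sq (Torus.laplacian h)) + (⨆ x, ‖Torus.gradient h x‖) * Real.sqrt E) * Real.sqrt (Torus.scalarL2Sq h)) * ∫ τ in Ici 0, Λ τ := by
  intro κ E s₀ u h φ Λ hκ0 hκ1 hh hsol hφs hE hΛ0 hΛint henv
  set L := Torus.scalarL2Sq h with hL_def
  set N := Real.sqrt L with hN_def
  set K := (Real.sqrt (Torus.scalarL2Sq (Torus.laplacian h)) +
    (⨆ x, ‖Torus.gradient h x‖) * Real.sqrt E) * N with hK_def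
  have hL0 : 0 ≤ L := Torus.scalarL2Sq_nonneg h
  have hN0 : 0 ≤ N := Real.sqrt_nonneg _
  have hK0 : 0 ≤ K :=
    mul_nonneg (add_nonneg (Real.sqrt_nonneg _)
      (mul_nonneg (Real.iSup_nonneg fun x => norm_nonneg _) (Real.sqrt_nonneg _))) hN0
  have hNN : N * N = L := Real.mul_self_sqrt hL0
  -- coherence + Cauchy–Schwarz + envelope: `L - K τ ≤ Λ τ · L` for `τ ≥ 0`
  have hstar : ∀ τ, 0 ≤ τ → L - K * τ ≤ Λ τ * L := by
    intro τ hτ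
    have ht : s₀ ≤ s₀ + τ := le_add_of_nonneg_right hτ
    have hcoh := stub_coherenceOfEnergy κ E s₀ u h φ hκ0 hκ1 hh hsol hφs hE (s₀ + τ) ht
    rw [add_sub_cancel_left] at hcoh
    have hφt : Torus.IsSmooth (φ (s₀ + τ)) := hsol.smooth_scalar.isSmooth_slice (mem_Ici.2 ht)
    have hcs : ∫ x, h x * φ (s₀ + τ) x ≤ N * √(Torus.scalarL2Sq (φ (s₀ + τ))) :=
      ScalarAnomalySteadySourceFormal.ColdStartVariance.integral_mul_le_sqrt_mul_sqrt
        (hh.memLp 2) (hφt.memLp 2)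
    have henv' : Torus.scalarL2Sq (φ (s₀ + τ)) ≤ Λ τ ^ 2 * L := by
      simpa only [add_sub_cancel_left] using henv (s₀ + τ) ht
    have hsq : √(Torus.scalarL2Sq (φ (s₀ + τ))) ≤ Λ τ * N :=
      calc √(Torus.scalarL2Sq (φ (s₀ + τ))) ≤ √(Λ τ ^ 2 * L) := Real.sqrt_le_sqrt henv'
        _ = Λ τ * N := by rw [Real.sqrt_mul (sq_nonneg _), Real.sqrt_sq (hΛ0 τ)]
    calc L - K * τ ≤ ∫ x, h x * φ (s₀ + τ) x := hcoh
      _ ≤ N * √(Torus.scalarL2Sq (φ (s₀ + τ))) := hcs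
      _ ≤ N * (Λ τ * N) := mul_le_mul_of_nonneg_left hsq hN0
      _ = Λ τ * L := by rw [← hNN]; ring
  exact le_two_mul_mul_integral_of_envelope hL0 hK0 hΛ0 hΛint hstar

end Summit.AnomalousDissipation.AnomalousDissipation.Theorems.TwohalfdThesis

end
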